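import Summits.CriticalPhenomena.PercolationContinuityZ3.Theorems.PercNearOneGluingNoHeavyLowerTailSahiCTCLadderRowTwoFive
import HarnessLib

/-!
# `NoHeavyLowerTail` (crux stmt-CriticalPhenomena-4575), P3 lane: the row `#dbl = 2` of `(L_6)` (the signs discharged for `t = 6`)

Support file (seat `prim-l12-p3`, gen 26; `--supports stmt-CriticalPhenomena-4575`).  Memo g26 §4.16.  Same recipe as `…LadderRowTwoFour/Five`:
`120·cH(6,k) = k⁵ − 5k⁴ + 25k³ + 5k² + 94k + 120`, closed forms in `ℚ`, Taylor positivity of the six multipliers at `n = 10`;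
**`coeff_ladder_six_rowTwo_nonneg`**: row `#dbl = 2` of `(L_6)` for every profile with `τ = #(lev m 1) ≥ 14`.  Nothing is asserted
about the crux.
-/

namespace Summit.CriticalPhenomena.PercolationContinuityZ3.Theorems.SahiCTCForms

open Finset MvPolynomial SahiCTCGenFun SahiCTCWeightedLYM

variable {α : Type*} [DecidableEq α] [Fintype α]

omit [DecidableEq α] [Fintype α] in
/-- `120·cH(6,k) = k⁵ − 5k⁴ + 25k³ + 5k² + 94k + 120` for `k ≥ 11`. [this work] -/
theorem onetwenty_mul_cH_six {k : ℕ} (hk : 11 ≤ k) :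
    120 * (cH 6 k : ℤ) = (k : ℤ) ^ 5 - 5 * (k : ℤ) ^ 4 + 25 * (k : ℤ) ^ 3 + 5 * (k : ℤ) ^ 2 + 94 * k + 120 := by
  unfold cH
  rw [show min 6 (k + 1 - 6) = 6 from by omega]
  simp only [sum_range_succ, sum_range_zero, Nat.choose_zero_right, Nat.choose_one_right, zero_add, Nat.cast_add, Nat.cast_one]
  have h2 : (k.choose 2 : ℤ) * 2 = (k : ℤ) * (k - 1) := by
    have h := Nat.choose_two_right k
    have : k.choose 2 * 2 = k * (k - 1) := by rw [h]; exact Nat.div_mul_cancel (Nat.even_mul_pred_self k).two_dvd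
    have := congrArg (fun x : ℕ => (x : ℤ)) this; push_cast [Nat.cast_sub (show 1 ≤ k by omega)] at this; linarith
  have h3 : (k.choose 3 : ℤ) * 6 = (k : ℤ) * (k - 1) * (k - 2) := by
    have h := Nat.choose_succ_right_eq k 2
    have := congrArg (fun x : ℕ => (x : ℤ)) h; push_cast [Nat.cast_sub (show 2 ≤ k by omega)] at this
    nlinarith [this, h2]
  have h4 : (k.choose 4 : ℤ) * 24 = (k : ℤ) * (k - 1) * (k - 2) * (k - 3) := by
    have h := Nat.choose_succ_right_eq k 3
    have := congrArg (fun x : ℕ => (x : ℤ)) h; push_cast [Nat.cast_sub (show 3 ≤ k by omega)] at this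
    nlinarith [this, h3]
  have h5 : (k.choose 5 : ℤ) * 120 = (k : ℤ) * (k - 1) * (k - 2) * (k - 3) * (k - 4) := by
    have h := Nat.choose_succ_right_eq k 4
    have := congrArg (fun x : ℕ => (x : ℤ)) h; push_cast [Nat.cast_sub (show 4 ≤ k by omega)] at this
    nlinarith [this, h4]
  nlinarith [h2, h3, h4, h5]

/-- **ROW `#dbl = 2` OF `(L_6)`** (`τ ≥ 14`): the general certificate with its four signs discharged for `t = 6`. [this work] -/
theorem coeff_ladder_six_rowTwo_nonneg {𝒳 𝒵 : Finset (Finset α)} (h𝒳 : IsUpperSet (𝒳 : Set (Finset α)))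
    (h𝒵 : IsUpperSet (𝒵 : Set (Finset α))) (hX6 : ∀ S ∈ 𝒳, 6 ≤ #S) (hZ6 : ∀ S ∈ 𝒵, 6 ≤ #S)
    {m : α →₀ ℕ} (hm : ∀ i, m i ≤ 2) (hD : #(dbl m) = 2) (hτ : 14 ≤ #(lev m 1)) :
    0 ≤ (ee 6 * (PiP * gf (𝒳 ∩ 𝒵) - gf 𝒳 * gf 𝒵) -
      gf (bySize (· ≤ 6 - 1) : Finset (Finset α)) * gf (bySize (6 ≤ ·) : Finset (Finset α)) *
        gf ((𝒳 ∩ 𝒵).filter fun S => #S = 6)).coeff m := by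
  obtain ⟨n, hn⟩ : ∃ n : ℕ, #(lev m 1) + 2 = n + 6 := ⟨#(lev m 1) - 4, by omega⟩
  have hn10 : 10 ≤ n := by omega
  have e6 : 120 * (cH 6 (n + 1) : ℤ) = ((n : ℤ) + 1) ^ 5 - 5 * ((n : ℤ) + 1) ^ 4 + 25 * ((n : ℤ) + 1) ^ 3 + 5 * ((n : ℤ) + 1) ^ 2
      + 94 * ((n : ℤ) + 1) + 120 := by
    have := onetwenty_mul_cH_six (k := n + 1) (by omega); push_cast at this; linarith
  have e5 : 24 * (cH 5 (n + 1) : ℤ) = ((n : ℤ) + 1) ^ 4 - 2 * ((n : ℤ) + 1) ^ 3 + 11 * ((n : ℤ) + 1) ^ 2 + 14 * ((n : ℤ) + 1) + 24 := by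
    have := twentyfour_mul_cH_five (k := n + 1) (by omega); push_cast at this; linarith
  have e5' : 24 * (cH 5 (n - 1) : ℤ) = ((n : ℤ) - 1) ^ 4 - 2 * ((n : ℤ) - 1) ^ 3 + 11 * ((n : ℤ) - 1) ^ 2 + 14 * ((n : ℤ) - 1) + 24 := by
    obtain ⟨k, hk⟩ : ∃ k, n = k + 1 := ⟨n - 1, by omega⟩
    rw [hk, Nat.add_sub_cancel]; have := twentyfour_mul_cH_five (k := k) (by omega); push_cast; linarith
  have e4 : 6 * (cH 4 (n - 1) : ℤ) = ((n : ℤ) - 1) ^ 3 + 5 * ((n : ℤ) - 1) + 6 := by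
    obtain ⟨k, hk⟩ : ∃ k, n = k + 1 := ⟨n - 1, by omega⟩
    rw [hk, Nat.add_sub_cancel]; have := six_mul_cH_four (k := k) (by omega); push_cast; linarith
  have e4' : 6 * (cH 4 (n - 2) : ℤ) = ((n : ℤ) - 2) ^ 3 + 5 * ((n : ℤ) - 2) + 6 := by
    obtain ⟨k, hk⟩ : ∃ k, n = k + 2 := ⟨n - 2, by omega⟩
    rw [hk, Nat.add_sub_cancel]; have := six_mul_cH_four (k := k) (by omega); push_cast; linarith
  have q6 : ((cH 6 (n + 1) : ℕ) : ℚ) = (((n : ℚ) + 1) ^ 5 - 5 * ((n : ℚ) + 1) ^ 4 + 25 * ((n : ℚ) + 1) ^ 3 + 5 * ((n : ℚ) + 1) ^ 2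
      + 94 * ((n : ℚ) + 1) + 120) / 120 := by
    have h : (120 : ℚ) * ((cH 6 (n + 1) : ℕ) : ℚ) = ((n : ℚ) + 1) ^ 5 - 5 * ((n : ℚ) + 1) ^ 4 + 25 * ((n : ℚ) + 1) ^ 3
        + 5 * ((n : ℚ) + 1) ^ 2 + 94 * ((n : ℚ) + 1) + 120 := by exact_mod_cast e6
    linarith
  have q5 : ((cH 5 (n + 1) : ℕ) : ℚ) = (((n : ℚ) + 1) ^ 4 - 2 * ((n : ℚ) + 1) ^ 3 + 11 * ((n : ℚ) + 1) ^ 2 + 14 * ((n : ℚ) + 1) + 24) / 24 := by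
    have h : (24 : ℚ) * ((cH 5 (n + 1) : ℕ) : ℚ) = ((n : ℚ) + 1) ^ 4 - 2 * ((n : ℚ) + 1) ^ 3 + 11 * ((n : ℚ) + 1) ^ 2 + 14 * ((n : ℚ) + 1) + 24 := by
      exact_mod_cast e5
    linarith
  have q5' : ((cH 5 (n - 1) : ℕ) : ℚ) = (((n : ℚ) - 1) ^ 4 - 2 * ((n : ℚ) - 1) ^ 3 + 11 * ((n : ℚ) - 1) ^ 2 + 14 * ((n : ℚ) - 1) + 24) / 24 := by
    have h : (24 : ℚ) * ((cH 5 (n - 1) : ℕ) : ℚ) = ((n : ℚ) - 1) ^ 4 - 2 * ((n : ℚ) - 1) ^ 3 + 11 * ((n : ℚ) - 1) ^ 2 + 14 * ((n : ℚ) - 1) + 24 := by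
      exact_mod_cast e5'
    linarith
  have q4 : ((cH 4 (n - 1) : ℕ) : ℚ) = (((n : ℚ) - 1) ^ 3 + 5 * ((n : ℚ) - 1) + 6) / 6 := by
    have h : (6 : ℚ) * ((cH 4 (n - 1) : ℕ) : ℚ) = ((n : ℚ) - 1) ^ 3 + 5 * ((n : ℚ) - 1) + 6 := by exact_mod_cast e4
    linarith
  have q4' : ((cH 4 (n - 2) : ℕ) : ℚ) = (((n : ℚ) - 2) ^ 3 + 5 * ((n : ℚ) - 2) + 6) / 6 := by
    have h : (6 : ℚ) * ((cH 4 (n - 2) : ℕ) : ℚ) = ((n : ℚ) - 2) ^ 3 + 5 * ((n : ℚ) - 2) + 6 := by exact_mod_cast e4'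
    linarith
  have hk : (0 : ℚ) ≤ (n : ℚ) - 10 := by
    have : ((10 : ℕ) : ℚ) ≤ n := by exact_mod_cast hn10
    push_cast at this; linarith
  have hk2 := mul_nonneg hk hk
  have hk3 := pow_nonneg hk 3
  have hk4 := pow_nonneg hk 4
  have hk5 := pow_nonneg hk 5
  have hk6 := pow_nonneg hk 6
  have hk7 := pow_nonneg hk 7
  have hk8 := pow_nonneg hk 8
  have hk9 := pow_nonneg hk 9
  have hk10 := pow_nonneg hk 10
  have hk11 := pow_nonneg hk 11
  have hk12 := pow_nonneg hk 12
  have hk13 := pow_nonneg hk 13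
  have hk14 := pow_nonneg hk 14
  have hk15 := pow_nonneg hk 15
  have hk16 := pow_nonneg hk 16
  refine coeff_ladder_rowTwoT_nonneg_of_signs h𝒳 h𝒵 (t := 6) (by norm_num) hX6 hZ6 hm hD hn (by omega) ?_ ?_ ?_ ?_ ?_ ?_
  all_goals
    first
    | refine Int.cast_nonneg_iff.1 (?_ : (0 : ℚ) ≤ _)
    | refine Int.cast_pos.1 (?_ : (0 : ℚ) < _)
  all_goals
    push_cast
    simp only [q6, q5, q5', q4, q4']
    linarith only [hk, hk2, hk3, hk4, hk5, hk6, hk7, hk8, hk9, hk10, hk11, hk12, hk13, hk14, hk15, hk16]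

end Summit.CriticalPhenomena.PercolationContinuityZ3.Theorems.SahiCTCForms
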